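import Literature.NumberTheory.Automorphic.ArithmeticQuotientCohomologyFinite
import Mathlib.GroupTheory.Commensurable
import Mathlib.Topology.Algebra.OpenSubgroup
import HarnessLib

/-!
# The stabilisers of the components of an arithmetic quotient of `GL_n` are arithmetic groups

Topic `NumberTheory/Automorphic`; namespace `Literature.NumberTheory.Automorphic` (grouping
sub-namespaces `BigHeckeGLn`, `TwistedQuotient` of the objects concerned).  Theorems only (no
definition, no named fact, no instance).

In the Shapiro decomposition `H^q(GL_n(K), Fun(GL_n(𝔸_K^∞)/U, V)) ≅ Π_x H^q(Γ_x, V)`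
(`CuspidalCohomologyGLShapiroSum`, `TwistedCohomologyFiniteOrbits`) the groups
`Γ_x = Stab_{GL_n(K)}(xU) = GL_n(K) ∩ x U x⁻¹` (`TwistedQuotient.orbitStabilizer`) are ARITHMETIC
subgroups of `GL_n(K)`: commensurable with `GL_n(𝓞_K)`.  This is the hypothesis under which the
finiteness theorems of Borel–Serre / Raghunathan / Serre for arithmetic groups are stated
([Serre1971CohomologieGroupesDiscrets, §2.4: "`Γ` … est dit `S`-arithmétique s'il est commensurable
à `Γ_S`"], here `Γ_S = GL_n(𝓞_K)`), so it is the bridge from those theorems to the adelic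
cohomology `TwistedQuotient.cohomology (globalEmbedding n K) U ρ q` of the tree.

* `Subgroup.commensurable_comap_of_isCompact_isOpen` — the preimages of two compact open
  subgroups under any homomorphism are commensurable (an open subgroup meets a compact subgroup
  in a subgroup of finite index of the latter, `relIndex_ne_zero_of_isOpen_of_isCompact` of
  `HeckeAlgebra`);
* `BigHeckeGLn.comap_glFiniteIntegralLevel_globalEmbedding` — **`GL_n(K) ∩ GL_n(𝒪̂_K) = GL_n(𝓞_K)`**
  (`K ∩ 𝒪̂_K = 𝓞_K`, `algebraMap_mem_integralFiniteAdeles_iff`);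
* `TwistedQuotient.orbitStabilizer_eq_comap_stabilizer` — `Γ_x = ι⁻¹(Stab_𝒢(x))`;
* `BigHeckeGLn.commensurable_orbitStabilizer_glIntegers` — **`Γ_x` is commensurable with
  `GL_n(𝓞_K)`** for every compact open `U ≤ GL_n(𝔸_K^∞)` and every coset `x`
  (the stabiliser `x U x⁻¹` is compact open, `TwistedQuotient.isOpen_stabilizer_coe`,
  `isCompact_stabilizer_coe`; `GL_n(𝒪̂_K)` is compact open, `isCompact_glFiniteIntegralLevel_holds`);
  `BigHeckeGLn.commensurable_comap_globalEmbedding_glIntegers` — the same for the congruence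
  subgroup `GL_n(K) ∩ U` itself.

## References

* J.-P. Serre, *Cohomologie des groupes discrets*, Ann. of Math. Studies 70 (1971), §2.4
  (definition of `S`-arithmetic subgroups) [Serre1971CohomologieGroupesDiscrets].
* V. Platonov, A. Rapinchuk, *Algebraic groups and number theory* (1994), §4.1 (arithmetic
  subgroups; congruence subgroups are arithmetic) [PlatonovRapinchuk1994].
-/

noncomputable section

open NumberField IsDedekindDomain
open scoped MatrixGroups

/-! ### Compact open subgroups: finite index and commensurability of preimages -/

namespace Subgroup

variable {G : Type*} [Group G] [TopologicalSpace G] [IsTopologicalGroup G]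

/-- **The preimages of two compact open subgroups under a group homomorphism are
commensurable**: an open subgroup meets a compact subgroup in a subgroup of finite index of the
latter (`V ⊓ W` is open in the compact group `V`, so `V / (V ⊓ W)` is compact and discrete;
`Literature.NumberTheory.Automorphic.relIndex_ne_zero_of_isOpen_of_isCompact` of `HeckeAlgebra`),
and finite index passes to preimages (Mathlib `Subgroup.relIndex_comap_ne_zero`).  Deliberate
dot-notation extension of Mathlib's `Subgroup`. [folklore] -/
theorem commensurable_comap_of_isCompact_isOpen {Γ : Type*} [Group Γ] (f : Γ →* G)
    (V W : Subgroup G) (hVc : IsCompact (V : Set G)) (hVo : IsOpen (V : Set G))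
    (hWc : IsCompact (W : Set G)) (hWo : IsOpen (W : Set G)) :
    (V.comap f).Commensurable (W.comap f) :=
  ⟨Subgroup.relIndex_comap_ne_zero f
      (Literature.NumberTheory.Automorphic.relIndex_ne_zero_of_isOpen_of_isCompact hVo hWc),
    Subgroup.relIndex_comap_ne_zero f
      (Literature.NumberTheory.Automorphic.relIndex_ne_zero_of_isOpen_of_isCompact hWo hVc)⟩

end Subgroup

namespace Literature.NumberTheory.Automorphic

/-! ### `Γ_x = ι⁻¹(Stab(x))` -/

namespace TwistedQuotient

universe u

variable {Γ 𝒢 : Type u} [Group Γ] [Group 𝒢] (ι : Γ →* 𝒢) (L : Subgroup 𝒢)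

/-- The stabiliser `Γ_x` of a coset in `Γ` is the preimage of its stabiliser in `𝒢`.
[folklore] -/
theorem orbitStabilizer_eq_comap_stabilizer (x : 𝒢 ⧸ L) :
    orbitStabilizer ι L x = (MulAction.stabilizer 𝒢 x).comap ι := by
  ext γ
  rw [mem_orbitStabilizer_iff, Subgroup.mem_comap, MulAction.mem_stabilizer_iff]

end TwistedQuotient

/-! ### `GL_n(K) ∩ GL_n(𝒪̂_K) = GL_n(𝓞_K)` and arithmeticity of the stabilisers -/

namespace BigHeckeGLn

variable (n : ℕ) (K : Type) [Field K] [NumberField K]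

/-- The entries of `ι(γ) ∈ GL_n(𝔸_K^∞)` are the images of the entries of `γ ∈ GL_n(K)`.
[folklore] -/
theorem coe_globalEmbedding_apply (γ : GL (Fin n) K) (i j : Fin n) :
    ((globalEmbedding n K γ : FiniteAdelicGL n K) : Matrix (Fin n) (Fin n) (FiniteAdeleRing (𝓞 K) K))
      i j = algebraMap K (FiniteAdeleRing (𝓞 K) K) ((γ : Matrix (Fin n) (Fin n) K) i j) := rfl

/-- **`GL_n(K) ∩ GL_n(𝒪̂_K) = GL_n(𝓞_K)`**: an element of `GL_n(K)` whose diagonal image lies in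
`GL_n(𝒪̂_K)` (it and its inverse have entries in `𝒪̂_K`) comes from `GL_n(𝓞_K)`, since
`K ∩ 𝒪̂_K = 𝓞_K` (`algebraMap_mem_integralFiniteAdeles_iff`), and conversely. [folklore] -/
theorem comap_glFiniteIntegralLevel_globalEmbedding :
    (glFiniteIntegralLevel n K).comap (globalEmbedding n K) =
      (Matrix.GeneralLinearGroup.map (algebraMap (𝓞 K) K) :
        GL (Fin n) (𝓞 K) →* GL (Fin n) K).range := by
  ext γ
  rw [Subgroup.mem_comap, mem_glFiniteIntegralLevel_iff, MonoidHom.mem_range]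
  constructor
  · rintro ⟨h1, h2⟩
    -- entries of `γ` and `γ⁻¹` are integers
    have h1' : ∀ i j, ∃ r : 𝓞 K, algebraMap (𝓞 K) K r = (γ : Matrix (Fin n) (Fin n) K) i j :=
      fun i j => by
        have h := h1 i j
        rw [coe_globalEmbedding_apply, algebraMap_mem_integralFiniteAdeles_iff] at h
        exact h
    have h2' : ∀ i j, ∃ r : 𝓞 K, algebraMap (𝓞 K) K r =
        ((γ⁻¹ : GL (Fin n) K) : Matrix (Fin n) (Fin n) K) i j := fun i j => by
      have h := h2 i j
      rw [← map_inv, coe_globalEmbedding_apply, algebraMap_mem_integralFiniteAdeles_iff] at h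
      exact h
    choose a ha using h1'
    choose b hb using h2'
    have hinj : Function.Injective
        ((algebraMap (𝓞 K) K).mapMatrix : Matrix (Fin n) (Fin n) (𝓞 K) → Matrix (Fin n) (Fin n) K) :=
      fun M N h => Matrix.ext fun i j =>
        IsFractionRing.injective (𝓞 K) K (congrFun (congrFun h i) j)
    have hA : (algebraMap (𝓞 K) K).mapMatrix (Matrix.of a) = (γ : Matrix (Fin n) (Fin n) K) :=
      Matrix.ext fun i j => ha i j
    have hB : (algebraMap (𝓞 K) K).mapMatrix (Matrix.of b) =
        ((γ⁻¹ : GL (Fin n) K) : Matrix (Fin n) (Fin n) K) := Matrix.ext fun i j => hb i j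
    have hAB : Matrix.of a * Matrix.of b = 1 := hinj (by
      rw [map_mul, hA, hB, map_one, ← Matrix.GeneralLinearGroup.coe_mul, mul_inv_cancel]
      rfl)
    have hBA : Matrix.of b * Matrix.of a = 1 := hinj (by
      rw [map_mul, hA, hB, map_one, ← Matrix.GeneralLinearGroup.coe_mul, inv_mul_cancel]
      rfl)
    refine ⟨⟨Matrix.of a, Matrix.of b, hAB, hBA⟩, Units.ext ?_⟩
    exact hA
  · rintro ⟨g, rfl⟩
    have hint : ∀ (g : GL (Fin n) (𝓞 K)) (i j : Fin n),
        ((globalEmbedding n K (Matrix.GeneralLinearGroup.map (algebraMap (𝓞 K) K) g) :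
          FiniteAdelicGL n K) : Matrix (Fin n) (Fin n) (FiniteAdeleRing (𝓞 K) K)) i j ∈
            integralFiniteAdeles K := fun g i j => by
      rw [coe_globalEmbedding_apply, algebraMap_mem_integralFiniteAdeles_iff]
      exact ⟨(g : Matrix (Fin n) (Fin n) (𝓞 K)) i j, rfl⟩
    refine ⟨hint g, fun i j => ?_⟩
    rw [← map_inv, ← map_inv]
    exact hint g⁻¹ i j

variable {n K}

/-- **The congruence subgroup `GL_n(K) ∩ U` of a compact open `U ≤ GL_n(𝔸_K^∞)` is arithmetic**:
commensurable with `GL_n(𝓞_K) = GL_n(K) ∩ GL_n(𝒪̂_K)` (preimages of the compact open subgroups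
`U`, `GL_n(𝒪̂_K)`; `isOpen_glFiniteIntegralLevel`, `isCompact_glFiniteIntegralLevel_holds`).
[cite: PlatonovRapinchuk1994, §4.1] -/
theorem commensurable_comap_globalEmbedding_glIntegers (U : Subgroup (FiniteAdelicGL n K))
    (hUo : IsOpen (U : Set (FiniteAdelicGL n K))) (hUc : IsCompact (U : Set (FiniteAdelicGL n K))) :
    (U.comap (globalEmbedding n K)).Commensurable
      (Matrix.GeneralLinearGroup.map (algebraMap (𝓞 K) K) :
        GL (Fin n) (𝓞 K) →* GL (Fin n) K).range := by
  rw [← comap_glFiniteIntegralLevel_globalEmbedding]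
  exact Subgroup.commensurable_comap_of_isCompact_isOpen (globalEmbedding n K) U
    (glFiniteIntegralLevel n K) hUc hUo (isCompact_glFiniteIntegralLevel_holds n K)
    (isOpen_glFiniteIntegralLevel n K)

/-- **The stabilisers `Γ_x = GL_n(K) ∩ x U x⁻¹` of the components of the arithmetic quotient
`GL_n(K)\GL_n(𝔸_K^∞)/U` are arithmetic subgroups of `GL_n(K)`** — commensurable with `GL_n(𝓞_K)` —
for every compact open `U` and every coset `x` (`Γ_x = ι⁻¹(Stab(x))` and `Stab(xU) = x U x⁻¹` is
compact open).  This is the hypothesis of the Borel–Serre / Serre finiteness theorems for the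
groups appearing in the Shapiro decomposition of `TwistedQuotient.cohomology (globalEmbedding n K) U ρ q`.
[cite: Serre1971CohomologieGroupesDiscrets, §2.4 (S-arithmetic subgroups)]
[cite: PlatonovRapinchuk1994, §4.1] -/
theorem commensurable_orbitStabilizer_glIntegers (U : Subgroup (FiniteAdelicGL n K))
    (hUo : IsOpen (U : Set (FiniteAdelicGL n K))) (hUc : IsCompact (U : Set (FiniteAdelicGL n K)))
    (x : FiniteAdelicGL n K ⧸ U) :
    (TwistedQuotient.orbitStabilizer (globalEmbedding n K) U x).Commensurable
      (Matrix.GeneralLinearGroup.map (algebraMap (𝓞 K) K) :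
        GL (Fin n) (𝓞 K) →* GL (Fin n) K).range := by
  rw [TwistedQuotient.orbitStabilizer_eq_comap_stabilizer]
  exact commensurable_comap_globalEmbedding_glIntegers _
    (TwistedQuotient.isOpen_stabilizer_coe U hUo x) (TwistedQuotient.isCompact_stabilizer_coe U hUc x)

end BigHeckeGLn

end Literature.NumberTheory.Automorphic
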